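import Literature.NumberTheory.LFunctions.RHWave0
import Literature.NumberTheory.LFunctions.ClassGroupLFunctionExceptionalZeroQuadraticField
import Literature.NumberTheory.QuadraticFields.ImaginaryResiduePiForm
import HarnessLib

/-!
# Conditional (GRH) explicit bounds for `L(1, χ)` and for class numbers of imaginary quadratic
# fields (Lamzouri–Li–Soundararajan, Math. Comp. 84 (2015), §1.3: Theorem 1.5 and Corollary 1.3)

Topic `Literature/NumberTheory/LFunctions` (namespace `Literature.NumberTheory.LFunctions`). Statement
layer (one file for §1.3 of the source, D-0064), typed for the cells `parity-realchar` (conditionals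
column: what GRH says about `L(1, χ)` — the explicit two-sided bound that replaces both the
exceptional-character world and Siegel's ineffective constant) and `landau-siegel` (§C: explicit
`L(1)`-floors). Source: Y. Lamzouri, X. Li, K. Soundararajan, *Conditional bounds for the least
quadratic non-residue and related problems*, Math. Comp. **84** (2015), no. 295, 2391–2412,
doi:10.1090/S0025-5718-2015-02925-1 = arXiv:1309.3595 [LamzouriLiSoundararajan2015] (journal PDF read,
pp. 2393–2395). The Corrigendum, Math. Comp. **86** (2017) 2551–2554 [LamzouriLiSoundararajan2017Corrigendum],
corrects ONLY the asymptotic Theorems 1.2 and 1.3 of the paper: "All the other results in the paper,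
including all explicit bounds, remain unaltered" (p. 2551) — so Theorem 1.5 and Corollary 1.3 stand as
printed in 2015.

## What the source says (verbatim, pp. 2393–2394)

* **Theorem 1.5.** "Assume GRH. Let `q` be a positive integer and `χ` be a primitive character modulo
  `q`. For `q ≥ 10¹⁰` we have
  `|L(1, χ)| ≤ 2e^γ (log log q − log 2 + 1/2 + 1/log log q)`
  and
  `1/|L(1, χ)| ≤ (12e^γ/π²) (log log q − log 2 + 1/2 + 1/log log q + 14 log log q/log q)`."
* (p. 2394) "let `−q` be a fundamental discriminant with `q > 4` and let `χ_{−q}(n) = (−q/n)` be the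
  Kronecker symbol, which is a primitive Dirichlet character (mod `q`). Moreover, denote by `h(−q)` the
  class number of the imaginary quadratic field `ℚ(√−q)`. Then, the Dirichlet class number formula
  reads (1.3) `h(−q) = (√q/π) L(1, χ_{−q})`. […] From Theorem 1.5 we obtain the following corollary.
  **Corollary 1.3.** Assume GRH. Let `−q` be a fundamental discriminant, and let `h(−q)` denote the
  class number of `ℚ(√−q)`. If `q ≥ 10¹⁰` then
  `h(−q) ≥ (π/(12e^γ)) √q (log log q − log 2 + 1/2 + 1/log log q + 14 log log q/log q)⁻¹`
  and
  `h(−q) ≤ (2e^γ/π) √q (log log q − log 2 + 1/2 + 1/log log q)`."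
  ("From our corollary it follows that on GRH `h(−q) ≥ 9053` when `q ≥ 10¹¹`" — index only.)
* GRH (p. 2395): the non-trivial zeros `ρ_χ` of `ξ(s, χ)`, `χ` primitive (and of `ξ(s)`), satisfy
  `ρ_χ = 1/2 + iγ_χ` ("throughout the paper we assume the truth of the GRH") — the tree's
  `GeneralizedRiemannHypothesis` (`RHWave0.lean`: every zero of every Dirichlet `L(s, χ)` with
  `0 < Re s < 1` has `Re s = 1/2`; all moduli, so `ζ` included).
* The closing remark of §1.3 (RH bounds for `|ζ(1+it)|^{±1}`, `t ≥ 10¹⁰`, "we … content ourselves by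
  stating") is a statement without proof in the source and is NOT typed.

## How it is typed

* `LamzouriLiSoundararajan2015.upperBracket q = log log q − log 2 + 1/2 + 1/log log q` and
  `LamzouriLiSoundararajan2015.lowerBracket q = upperBracket q + 14 log log q/log q` (definitions with
  bodies; PROVED positive for `q ≥ 3 > e`, `upperBracket_pos` / `lowerBracket_pos`, via
  `t + 1/t ≥ 2 > log 2 − 1/2` for `t = log log q > 0`).
* `lamzouriLiSoundararajan2015_theorem15` — NAMED FACT, Theorem 1.5 verbatim as the implication
  "GRH ⇒ bounds", over Mathlib's `DirichletCharacter ℂ q`, `χ.IsPrimitive`, `(10:ℝ)^10 ≤ q`,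
  `|L(1, χ)| = ‖χ.LFunction 1‖`, `e^γ = Real.exp Real.eulerMascheroniConstant`. (For `q ≥ 10¹⁰` a
  primitive `χ` is non-trivial, so `L(1, χ) ≠ 0` and `1/|L(1, χ)|` is the honest reciprocal.)
* **Corollary 1.3 is PROVED** modulo Theorem 1.5 (`classNumber_bounds_of_theorem15`), exactly as the
  source says ("From Theorem 1.5 we obtain"), over imaginary quadratic fields `K` (`[K:ℚ] = 2`,
  `d_K < 0`, `q = |d_K|`; "fundamental discriminants `−q < 0`" ↔ "imaginary quadratic fields", tree
  `Quadratic.isFundamentalDiscriminant_discr` / `exists_numberField_discr_eq`), using the tree's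
  PROVED dictionary: the primitive Kronecker character `κ` mod `|d_K|` with `ζ_K = ζ·L(κ)`
  (`Quadratic.exists_primitive_kroneckerChar`), the class number formula
  `L(1, κ) = 2π h_K/(w_K √|d_K|)` (`Quadratic.LFunction_one_eq_of_discr_neg_of_eq`) and `w_K = 2` for
  `d_K < −4` (`Quadratic.torsionOrder_eq_two_of_discr_lt_neg_four`) — i.e. the printed (1.3).
  No new named fact for the corollary (D-0026).

LABEL (cell rule): statement layer; GRH is a HYPOTHESIS inside the fact (nothing is asserted about its
truth); no compute. WHAT THIS IS NOT: not an unconditional `L(1)`-floor (those are the tree's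
`sqrt_mul_norm_LFunction_one_ge_of_odd/even`, Siegel/Tatuzawa, and the certified leaves).

## Appended 2026-08-27 (same seat, g4): Languasco–Trudgian 2022 — the LLS bounds for EVERY `q ≥ 3`

A. Languasco, T. S. Trudgian, *Uniform effective estimates for `|L(1, χ)|`*, J. Number Theory 236 (2022)
245–260 = arXiv:2011.08348 [LanguascoTrudgian2022] (held arXiv TeX, read): "**Theorem 1.** Assume the
Generalised Riemann Hypothesis. Then, for `q ≥ 3` both (LLS-upper) and (LLS-lower) hold for every
non-principal primitive Dirichlet character `mod q`." ((LLS-upper)/(LLS-lower) = the two displays of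
Theorem 1.5 above, verbatim.) "**Corollary 1.** Assume the Generalised Riemann Hypothesis. Let `−q` be a
discriminant and let `h(−q)` denote the class number of `ℚ(√−q)`. For every `q ≥ 5` we have that
`h(−q) ≤ (2e^γ/π)√q(log log q − log 2 + ½ + 1/log log q)` and
`h(−q) ≥ (π/(12e^γ))√q(log log q − log 2 + ½ + 1/log log q + 14 log log q/log q)⁻¹`." ("Corollary 1
extends the range of validity of Corollary 1.3 of [LLS] from `q ≥ 10¹⁰` to `q ≥ 5`." Proof of Thm 1:
the LLS argument pushed to a smaller theoretical threshold plus a published numerical verification for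
the remaining `q` — a computer-assisted printed theorem, typed as a NAMED FACT like Watkins' tables.)
Typed: `languascoTrudgian2022_theorem1` (fact); PROVED `LanguascoTrudgian2022.theorem15_of`
(⟹ `lamzouriLiSoundararajan2015_theorem15`) and `LanguascoTrudgian2022.classNumber_bounds` (Corollary 1
for every imaginary quadratic field, `|d_K| ≥ 5`, by the proof of `classNumber_bounds_of_theorem15`) —
closing the range `|d| < 10¹⁰` that the g0 typing of this file had to leave open.

## References

* [LanguascoTrudgian2022] A. Languasco, T. S. Trudgian, J. Number Theory 236 (2022) 245–260 =
  arXiv:2011.08348, Theorem 1 and Corollary 1 (appended 2026-08-27).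

* [LamzouriLiSoundararajan2015] Y. Lamzouri, X. Li, K. Soundararajan, Math. Comp. 84 (2015) 2391–2412 —
  Theorem 1.5 (p. 2393), (1.3) and Corollary 1.3 (p. 2394), §2 p. 2395 (GRH), §5 (proof of Thm 1.5).
* [LamzouriLiSoundararajan2017Corrigendum] —, Corrigendum, Math. Comp. 86 (2017) 2551–2554, §1
  (only Theorems 1.2, 1.3 change).
* [MontgomeryVaughan2007] H. L. Montgomery, R. C. Vaughan, *Multiplicative Number Theory I*, Thm 9.13,
  §10.1 Exercise 26 (Kronecker character, `ζ_K = ζ L`).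
* [NeukirchANT1999] J. Neukirch, *Algebraic Number Theory*, VII §5 (5.11) (class number formula).
-/

noncomputable section

open Complex

namespace Literature.NumberTheory.LFunctions

namespace LamzouriLiSoundararajan2015

/-- The bracket of the first display of Theorem 1.5:
`log log q − log 2 + 1/2 + 1/log log q`. [cite: LamzouriLiSoundararajan2015, Theorem 1.5 p. 2393] -/
def upperBracket (q : ℝ) : ℝ :=
  Real.log (Real.log q) - Real.log 2 + 1 / 2 + 1 / Real.log (Real.log q)

/-- The bracket of the second display of Theorem 1.5 (and of the lower bound of Corollary 1.3):
`log log q − log 2 + 1/2 + 1/log log q + 14 log log q/log q`.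
[cite: LamzouriLiSoundararajan2015, Theorem 1.5 p. 2393] -/
def lowerBracket (q : ℝ) : ℝ :=
  Real.log (Real.log q) - Real.log 2 + 1 / 2 + 1 / Real.log (Real.log q) +
    14 * Real.log (Real.log q) / Real.log q

/-- `lowerBracket q = upperBracket q + 14 log log q/log q`. [cite: LamzouriLiSoundararajan2015, Theorem 1.5 p. 2393] -/
theorem lowerBracket_eq (q : ℝ) :
    lowerBracket q = upperBracket q + 14 * Real.log (Real.log q) / Real.log q := rfl

/-- For `q ≥ 3` (so `log q > 1`, `log log q > 0`) the bracket `log log q − log 2 + 1/2 + 1/log log q`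
is positive: `t + 1/t ≥ 2` for `t = log log q > 0` and `log 2 < 2 + 1/2` (so both printed bounds of
Theorem 1.5 are bounds by positive quantities). [cite: LamzouriLiSoundararajan2015, Theorem 1.5 p. 2393 (first bracket)] -/
theorem upperBracket_pos {q : ℝ} (hq : 3 ≤ q) : 0 < upperBracket q := by
  unfold upperBracket
  have hlogq : 1 < Real.log q := by
    rw [← Real.exp_lt_exp, Real.exp_log (by linarith)]
    have := Real.exp_one_lt_d9
    linarith
  have ht : 0 < Real.log (Real.log q) := Real.log_pos hlogq
  set t := Real.log (Real.log q) with ht_def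
  have hamgm : 2 ≤ t + 1 / t := by
    rw [← sub_nonneg]
    have : t + 1 / t - 2 = (t - 1) ^ 2 / t := by field_simp; ring
    rw [this]; positivity
  have hlog2 : Real.log 2 < 0.6931471808 := Real.log_two_lt_d9
  linarith

/-- For `q ≥ 3` the bracket `log log q − log 2 + 1/2 + 1/log log q + 14 log log q/log q` is positive.
[cite: LamzouriLiSoundararajan2015, Theorem 1.5 p. 2393 (second bracket)] -/
theorem lowerBracket_pos {q : ℝ} (hq : 3 ≤ q) : 0 < lowerBracket q := by
  rw [lowerBracket_eq]
  have hlogq : 1 < Real.log q := by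
    rw [← Real.exp_lt_exp, Real.exp_log (by linarith)]
    have := Real.exp_one_lt_d9
    linarith
  have ht : 0 < Real.log (Real.log q) := Real.log_pos hlogq
  have h1 := upperBracket_pos hq
  have h2 : 0 ≤ 14 * Real.log (Real.log q) / Real.log q := by positivity
  linarith

end LamzouriLiSoundararajan2015

open LamzouriLiSoundararajan2015

/-- **Lamzouri–Li–Soundararajan 2015, Theorem 1.5 (NAMED FACT, as printed).** "Assume GRH. Let `q` be a
positive integer and `χ` be a primitive character modulo `q`. For `q ≥ 10¹⁰` we have
`|L(1, χ)| ≤ 2e^γ (log log q − log 2 + 1/2 + 1/log log q)` and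
`1/|L(1, χ)| ≤ (12e^γ/π²) (log log q − log 2 + 1/2 + 1/log log q + 14 log log q/log q)`."
GRH = the tree's `GeneralizedRiemannHypothesis` (all Dirichlet `L`-functions, `ζ` included, as in the
source's §2). Explicit; unaffected by the 2017 Corrigendum; unproved here (explicit-formula method of
§§2, 5 of the source). [cite: LamzouriLiSoundararajan2015, Theorem 1.5 p. 2393]
[cite: LamzouriLiSoundararajan2017Corrigendum, §1 p. 2551 ("all explicit bounds remain unaltered")] -/
def lamzouriLiSoundararajan2015_theorem15 : Prop :=
  GeneralizedRiemannHypothesis →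
    ∀ (q : ℕ) [NeZero q] (χ : DirichletCharacter ℂ q), χ.IsPrimitive → (10 : ℝ) ^ 10 ≤ (q : ℝ) →
      ‖χ.LFunction 1‖ ≤ 2 * Real.exp Real.eulerMascheroniConstant * upperBracket q ∧
        1 / ‖χ.LFunction 1‖ ≤
          12 * Real.exp Real.eulerMascheroniConstant / Real.pi ^ 2 * lowerBracket q

namespace LamzouriLiSoundararajan2015

/-- **Lamzouri–Li–Soundararajan 2015, Corollary 1.3 (PROVED from Theorem 1.5 and the class number
formula, as in the source).** Under GRH, for every imaginary quadratic field `K` (`[K:ℚ] = 2`,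
`d_K < 0`) with `q = |d_K| ≥ 10¹⁰`:
`(π/(12e^γ)) √q (log log q − log 2 + 1/2 + 1/log log q + 14 log log q/log q)⁻¹ ≤ h_K` and
`h_K ≤ (2e^γ/π) √q (log log q − log 2 + 1/2 + 1/log log q)`.
Proof: the Kronecker character `κ` of `K` is primitive mod `|d_K|` with `ζ_K = ζ·L(κ)`, and (1.3)
`h_K = (√q/π) L(1, κ)` (class number formula with `w_K = 2` as `d_K < −4`).
[cite: LamzouriLiSoundararajan2015, Corollary 1.3 p. 2394 and (1.3)] -/
theorem classNumber_bounds_of_theorem15 (h : lamzouriLiSoundararajan2015_theorem15)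
    (hGRH : GeneralizedRiemannHypothesis) (K : Type*) [Field K] [NumberField K]
    (h2 : Module.finrank ℚ K = 2) (hd : NumberField.discr K < 0)
    (hq : (10 : ℝ) ^ 10 ≤ ((NumberField.discr K).natAbs : ℝ)) :
    Real.pi / (12 * Real.exp Real.eulerMascheroniConstant) *
          Real.sqrt ((NumberField.discr K).natAbs : ℝ) *
          (lowerBracket ((NumberField.discr K).natAbs : ℝ))⁻¹ ≤ (NumberField.classNumber K : ℝ) ∧
      (NumberField.classNumber K : ℝ) ≤
        2 * Real.exp Real.eulerMascheroniConstant / Real.pi *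
          Real.sqrt ((NumberField.discr K).natAbs : ℝ) *
          upperBracket ((NumberField.discr K).natAbs : ℝ) := by
  classical
  -- the primitive Kronecker character `κ` mod `M = |d_K|` with `ζ_K = ζ · L(κ)`
  obtain ⟨M, _, κ, hM, hκ1, -, hprim, hfac⟩ :=
    Literature.NumberTheory.QuadraticFields.Quadratic.exists_primitive_kroneckerChar (k := K) h2
  -- the class number formula `L(1, κ) = 2π h/(w √|d_K|)`, and `w = 2`
  have hcnf := Literature.NumberTheory.QuadraticFields.Quadratic.LFunction_one_eq_of_discr_neg_of_eq
    h2 hd hκ1 (fun s hs => hfac s (by simpa using hs))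
  have hd4 : NumberField.discr K < -4 := by
    have h10 : (10 : ℝ) ^ 10 ≤ ((NumberField.discr K).natAbs : ℤ) := by exact_mod_cast hq
    have habs : (((NumberField.discr K).natAbs : ℤ) : ℝ) = -(NumberField.discr K : ℝ) := by
      rw [Int.ofNat_natAbs_of_nonpos hd.le]; push_cast; ring
    rw [habs] at h10
    have : (NumberField.discr K : ℝ) < -4 := by nlinarith
    exact_mod_cast this
  have hw : (NumberField.Units.torsionOrder K : ℝ) = 2 := by
    exact_mod_cast
      Literature.NumberTheory.QuadraticFields.Quadratic.torsionOrder_eq_two_of_discr_lt_neg_four h2 hd4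
  have habsM : |(NumberField.discr K : ℝ)| = (M : ℝ) := by
    rw [← Int.cast_abs, Int.abs_eq_natAbs, Int.cast_natCast, hM]
  have hMq : ((NumberField.discr K).natAbs : ℝ) = (M : ℝ) := by rw [hM]
  rw [hMq]
  rw [habsM, hw] at hcnf
  -- `‖L(1, κ)‖ = π h / √M`
  have hM10 : (10 : ℝ) ^ 10 ≤ (M : ℝ) := by rw [← hMq]; exact hq
  have hM0 : (0 : ℝ) < M := lt_of_lt_of_le (by norm_num) hM10
  have hsqrt : 0 < Real.sqrt (M : ℝ) := Real.sqrt_pos.mpr hM0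
  have hh : (1 : ℝ) ≤ NumberField.classNumber K := by exact_mod_cast NumberField.classNumber_pos K
  have hπ : 0 < Real.pi := Real.pi_pos
  have hnorm : ‖κ.LFunction 1‖ = Real.pi * NumberField.classNumber K / Real.sqrt M := by
    rw [hcnf, Complex.norm_real, Real.norm_eq_abs, abs_of_nonneg (by positivity)]
    field_simp
  -- apply Theorem 1.5 to `κ`
  obtain ⟨hup, hlow⟩ := h hGRH M κ hprim hM10
  rw [hnorm] at hup hlow
  set γ' := Real.exp Real.eulerMascheroniConstant with hγ'
  have hγpos : 0 < γ' := Real.exp_pos _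
  constructor
  · -- lower bound: `√M/(π h) ≤ (12 e^γ/π²) · lowerBracket M`
    rw [one_div, inv_div] at hlow
    have hLpos : 0 < lowerBracket (M : ℝ) := lowerBracket_pos (by linarith)
    -- `π/(12 e^γ) · √M · lowerBracket⁻¹ ≤ h` ⟸ `√M ≤ (12 e^γ/π²) lowerBracket · π h`
    have hmain : Real.sqrt M ≤ 12 * γ' / Real.pi ^ 2 * lowerBracket M * (Real.pi * NumberField.classNumber K) := by
      have := (div_le_iff₀ (by positivity : (0 : ℝ) < Real.pi * NumberField.classNumber K)).mp hlow
      linarith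
    rw [mul_inv_le_iff₀ hLpos]
    rw [div_mul_eq_mul_div, div_le_iff₀ (by positivity)]
    calc Real.pi * Real.sqrt M
        ≤ Real.pi * (12 * γ' / Real.pi ^ 2 * lowerBracket M * (Real.pi * NumberField.classNumber K)) :=
          mul_le_mul_of_nonneg_left hmain hπ.le
      _ = NumberField.classNumber K * lowerBracket M * (12 * γ') := by
          field_simp
  · -- upper bound: `π h/√M ≤ 2 e^γ · upperBracket M`
    rw [div_le_iff₀ hsqrt] at hup
    rw [div_mul_eq_mul_div, div_mul_eq_mul_div, le_div_iff₀ hπ]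
    linarith

end LamzouriLiSoundararajan2015

/-! ### Languasco–Trudgian 2022: Theorem 1.5 for every `q ≥ 3` -/

/-- **Languasco–Trudgian 2022, Theorem 1 (NAMED FACT, as printed).** "Assume the Generalised Riemann
Hypothesis. Then, for `q ≥ 3` both (LLS-upper) and (LLS-lower) hold for every non-principal primitive
Dirichlet character `mod q`" — i.e. `|L(1,χ)| ≤ 2e^γ(log log q − log 2 + ½ + 1/log log q)` and
`1/|L(1,χ)| ≤ (12e^γ/π²)(log log q − log 2 + ½ + 1/log log q + 14 log log q/log q)`. GRH = the tree's
`GeneralizedRiemannHypothesis`, as for Theorem 1.5. (Computer-assisted for small `q`.) Unproved here.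
[cite: LanguascoTrudgian2022, Theorem 1] -/
def languascoTrudgian2022_theorem1 : Prop :=
  GeneralizedRiemannHypothesis →
    ∀ (q : ℕ) [NeZero q] (χ : DirichletCharacter ℂ q), χ.IsPrimitive → χ ≠ 1 → (3 : ℝ) ≤ (q : ℝ) →
      ‖χ.LFunction 1‖ ≤ 2 * Real.exp Real.eulerMascheroniConstant * upperBracket q ∧
        1 / ‖χ.LFunction 1‖ ≤
          12 * Real.exp Real.eulerMascheroniConstant / Real.pi ^ 2 * lowerBracket q

namespace LanguascoTrudgian2022

/-- A primitive character mod `q ≥ 2` is not the trivial character (whose conductor is `1`).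
[folklore] -/
private theorem ne_one_of_isPrimitive {q : ℕ} [NeZero q] {χ : DirichletCharacter ℂ q}
    (hprim : χ.IsPrimitive) (hq : 2 ≤ q) : χ ≠ 1 := by
  intro h1
  have hcond : χ.conductor = q := hprim
  rw [h1, DirichletCharacter.conductor_one] at hcond
  omega

/-- **Languasco–Trudgian's Theorem 1 implies Lamzouri–Li–Soundararajan's Theorem 1.5** (the range
`q ≥ 10¹⁰` is contained in `q ≥ 3`; a primitive character mod `q ≥ 10¹⁰` is non-principal).
[cite: LanguascoTrudgian2022, Theorem 1] -/
theorem theorem15_of (h : languascoTrudgian2022_theorem1) : lamzouriLiSoundararajan2015_theorem15 := by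
  intro hGRH q _ χ hprim hq
  have hq3 : (3 : ℝ) ≤ (q : ℝ) := le_trans (by norm_num) hq
  have hq2 : 2 ≤ q := by
    have : (2 : ℝ) ≤ (q : ℝ) := by linarith
    exact_mod_cast this
  exact h hGRH q χ hprim (ne_one_of_isPrimitive hprim hq2) hq3

/-- **Languasco–Trudgian 2022, Corollary 1 (PROVED from Theorem 1 and the class number formula, as in
the source).** Under GRH, for every imaginary quadratic field `K` (`[K:ℚ] = 2`, `d_K < 0`) with
`q = |d_K| ≥ 5`: `(π/(12e^γ)) √q · lowerBracket(q)⁻¹ ≤ h_K ≤ (2e^γ/π) √q · upperBracket(q)` — Corollary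
1.3 of Lamzouri–Li–Soundararajan on the whole range. [cite: LanguascoTrudgian2022, Corollary 1] -/
theorem classNumber_bounds (h : languascoTrudgian2022_theorem1)
    (hGRH : GeneralizedRiemannHypothesis) (K : Type*) [Field K] [NumberField K]
    (h2 : Module.finrank ℚ K = 2) (hd : NumberField.discr K < 0)
    (hq : (5 : ℝ) ≤ ((NumberField.discr K).natAbs : ℝ)) :
    Real.pi / (12 * Real.exp Real.eulerMascheroniConstant) *
          Real.sqrt ((NumberField.discr K).natAbs : ℝ) *
          (lowerBracket ((NumberField.discr K).natAbs : ℝ))⁻¹ ≤ (NumberField.classNumber K : ℝ) ∧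
      (NumberField.classNumber K : ℝ) ≤
        2 * Real.exp Real.eulerMascheroniConstant / Real.pi *
          Real.sqrt ((NumberField.discr K).natAbs : ℝ) *
          upperBracket ((NumberField.discr K).natAbs : ℝ) := by
  classical
  obtain ⟨M, _, κ, hM, hκ1, -, hprim, hfac⟩ :=
    Literature.NumberTheory.QuadraticFields.Quadratic.exists_primitive_kroneckerChar (k := K) h2
  have hcnf := Literature.NumberTheory.QuadraticFields.Quadratic.LFunction_one_eq_of_discr_neg_of_eq
    h2 hd hκ1 (fun s hs => hfac s (by simpa using hs))
  have hd4 : NumberField.discr K < -4 := by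
    have h5 : (5 : ℝ) ≤ ((NumberField.discr K).natAbs : ℤ) := by exact_mod_cast hq
    have habs : (((NumberField.discr K).natAbs : ℤ) : ℝ) = -(NumberField.discr K : ℝ) := by
      rw [Int.ofNat_natAbs_of_nonpos hd.le]; push_cast; ring
    rw [habs] at h5
    have : (NumberField.discr K : ℝ) < -4 := by linarith
    exact_mod_cast this
  have hw : (NumberField.Units.torsionOrder K : ℝ) = 2 := by
    exact_mod_cast
      Literature.NumberTheory.QuadraticFields.Quadratic.torsionOrder_eq_two_of_discr_lt_neg_four h2 hd4
  have habsM : |(NumberField.discr K : ℝ)| = (M : ℝ) := by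
    rw [← Int.cast_abs, Int.abs_eq_natAbs, Int.cast_natCast, hM]
  have hMq : ((NumberField.discr K).natAbs : ℝ) = (M : ℝ) := by rw [hM]
  rw [hMq]
  rw [habsM, hw] at hcnf
  have hM5 : (5 : ℝ) ≤ (M : ℝ) := by rw [← hMq]; exact hq
  have hM0 : (0 : ℝ) < M := lt_of_lt_of_le (by norm_num) hM5
  have hsqrt : 0 < Real.sqrt (M : ℝ) := Real.sqrt_pos.mpr hM0
  have hh : (1 : ℝ) ≤ NumberField.classNumber K := by exact_mod_cast NumberField.classNumber_pos K
  have hπ : 0 < Real.pi := Real.pi_pos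
  have hnorm : ‖κ.LFunction 1‖ = Real.pi * NumberField.classNumber K / Real.sqrt M := by
    rw [hcnf, Complex.norm_real, Real.norm_eq_abs, abs_of_nonneg (by positivity)]
    field_simp
  obtain ⟨hup, hlow⟩ := h hGRH M κ hprim hκ1 (by linarith)
  rw [hnorm] at hup hlow
  set γ' := Real.exp Real.eulerMascheroniConstant with hγ'
  have hγpos : 0 < γ' := Real.exp_pos _
  constructor
  · rw [one_div, inv_div] at hlow
    have hLpos : 0 < lowerBracket (M : ℝ) := lowerBracket_pos (by linarith)
    have hmain : Real.sqrt M ≤ 12 * γ' / Real.pi ^ 2 * lowerBracket M * (Real.pi * NumberField.classNumber K) := by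
      have := (div_le_iff₀ (by positivity : (0 : ℝ) < Real.pi * NumberField.classNumber K)).mp hlow
      linarith
    rw [mul_inv_le_iff₀ hLpos]
    rw [div_mul_eq_mul_div, div_le_iff₀ (by positivity)]
    calc Real.pi * Real.sqrt M
        ≤ Real.pi * (12 * γ' / Real.pi ^ 2 * lowerBracket M * (Real.pi * NumberField.classNumber K)) :=
          mul_le_mul_of_nonneg_left hmain hπ.le
      _ = NumberField.classNumber K * lowerBracket M * (12 * γ') := by
          field_simp
  · rw [div_le_iff₀ hsqrt] at hup
    rw [div_mul_eq_mul_div, div_mul_eq_mul_div, le_div_iff₀ hπ]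
    linarith

end LanguascoTrudgian2022

end Literature.NumberTheory.LFunctions

end
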